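import Literature.Probability.LatticeModels.UniformStepWalk
import Summits.ValiantsHypothesis.ValiantsHypothesis.Theorems.KPlusLogSqLawTropicalBTightnessCeiling

/-!
# Route «KPlusLogSqLaw», crux `TropicalB` (stmt-ValiantsHypothesis-19771) — the HALVING PRODUCT LAW: the dyadic halving recursion
# is QUASI-POLYNOMIALLY below `4^(m−1)·K`, and the counting-tightness threshold enters the crux window:
# `κ(2^s) ≤ 2^s − 2` for every `s ≥ 10`, `κ(2^s) ≤ 2^s − 1 − t` whenever `8t + 11s < s²`

HONEST FRAMING.  Helper toward the registered stubs `stub_tropThin` / `stub_tropFat` of `Cruxes/TropicalB/Lines/birth.lean` (crux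
`Summit.ValiantsHypothesis.ValiantsHypothesis.Theses.KPlusLogSqLaw.TropicalB`, item stmt-ValiantsHypothesis-19771, route KPlusLogSqLaw;
cell `pub-symmetroid`, seat val-sym-trop-p1 g20, 2026-08-28; `--supports … --as helper`).  UNCONDITIONAL census / structure bookkeeping in
the unsigned currency `TropRowD` (`…TropicalBSplitDefs`); it proves nothing about `TropicalB` in the bulk of its window and bears on neither
`WeakLifting`, DoorA26 / DoorA34, `MatrixDescartes` (stmt-ValiantsHypothesis-18050) nor VP ≠ VNP.  Vocabulary of the companion files
(`…TropicalBTightnessThreshold`, `…TropicalBTightnessCeiling`, val-sym-trop-p4 g12): the format `(m, K)` is COUNTING-TIGHT if some design has an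
unsigned dominant chain through all `multichoose K m = C(m+K−1, m)` class multisets, i.e. `¬ TropRowD m K (multichoose K m − 2)`; `κ(m)` = the
largest such `K` (the tight `K` form an initial segment `{2, …, κ(m)}`, `Tightness.tropRowD_notTight_mono`); state of record `κ(m) < 16m`
(halving in its closed form `T_D(m,K) ≤ 4^(m−1)·K − 1`, `IteratedHalving.tropRowD_four_pow`), while `TropicalB ⇒ κ(m) < C₀·log₂ m`
(`…TightnessThresholdLog`).  The crux window is `⌊log₂ m⌋ + 1 < K < m`; before this file no format inside it was known to be non-tight.

WHAT IS PROVED (all elementary, in `ℕ`; the two central-binomial estimates are REUSED, not restated: the upper Wallis bound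
`C(2n,n)²(3n+1) ≤ 16^n` is `Literature.Probability.LatticeModels.UniformStep.centralBinom_sq_mul_le`, the lower bound `4^n < n·C(2n,n)`
(`n ≥ 4`) is Mathlib's `Nat.four_pow_lt_mul_centralBinom`).
* §1 `sixteen_pow_pred_le : 4 ≤ m → 4·16^(m−1) ≤ m²·C(2m−1, m)²` (Erdős's bound squared, `C(2m,m) = 2·C(2m−1,m)`), and
  `multichoose m m = C(2m−1, m)` (the counting ceiling of the diagonal format).
* §2 THE HALVING PRODUCT LAW (`tropRowD_two_pow_prod`): iterating the landed halving inequality `tropRowD_halving` (val-sym-trop-p1 g0,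
  `T_D(c+e) + 1 ≤ C(c+e,c)·(T_D(c) + T_D(e) + 1)`) along EXACT halvings only,
  **`T_D(2^s, K) + 1 ≤ K · 2^s · ∏_{j<s} C(2^{j+1}, 2^j)`** for all `s, K` — the dyadic rows of the halving recursion kept as a product
  instead of being rounded up to `4^(m−1)·K` at every level (`s = 3`: `6720·K`, the tree's exact `(8, K)` halving row).
* §3 ITS SIZE: `prod_centralBinom_sq_mul_le : (∏_{j<s} C(2^{j+1},2^j))² · ∏_{j<s} (3·2^j + 1) ≤ 16^(2^s − 1)` and
  `three_pow_mul_two_pow_le_prod : 3^s · 2^(s(s−1)/2) ≤ ∏_{j<s} (3·2^j + 1)`, whence the closed form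
  `halvingProduct_closed_form : (K·2^s·∏)²·3^s·2^(s(s−1)/2) ≤ K²·4^s·16^(2^s − 1)`, i.e. at `m = 2^s`
  **`T_D(m, K) + 1 ≤ K · 4^(m−1) · 2^s · 3^(−s/2) · 2^(−s(s−1)/4) = K·4^(m−1) / m^{(log₂ m)/4 − O(1)}`** — the halving method is
  quasi-polynomially better than the tree's `4^(m−1)·K` (gain `3^{s/2}·2^{s(s−1)/4}/2^s = 2^{(s² − 1.83s)/4}`: `> 1` from `s = 2`, `≈ 2^20` at
  `m = 1024`, `≈ 2^90` at `m = 2^20`);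
  relevant in the super-fat corner `K ≳ m` and at the upper edge of the window (in the bulk of the window slope counting is smaller).
* §4 THE THRESHOLD ENTERS THE WINDOW.  With §1 and `3^t·C(2m−1−t, m) ≥ C(2m−1, m)` (`2t + 2 ≤ m`, `choose_le_three_pow_mul_choose_sub`), a
  tight format `(2^s, 2^s − t)` would force `4·∏_{j<s}(3·2^j+1) ≤ 9^t·64^s`; so
  `tropRowD_notTight_two_pow_sub : 2 ≤ s → 2t + 2 ≤ 2^s → 9^t·64^s < 4·∏_{j<s}(3·2^j+1) → TropRowD (2^s) (2^s − t) (multichoose (2^s − t) (2^s) − 2)`,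
  and numerically (`∏_{j<10}(3·2^j+1) ≈ 3.8·10^18 > 9·2^60/4`, each further factor `> 64`):
  **`κ(2^s) < 2^s` for every `s ≥ 10`** (`tropRowD_notTight_diag`; all `K ≥ 2^s` by propagation, `tropRowD_notTight_two_pow_le`),
  **`κ(2^s) ≤ 2^s − 2` for every `s ≥ 10`** (`tropRowD_notTight_window_one` / `_le`: the formats `(2^s, 2^s − 1)`, `s ≥ 10` — e.g. `(1024, 1023)` —
  are the first decided NON-tight formats strictly inside the crux window), and asymptotically
  **`κ(2^s) ≤ 2^s − 1 − t` whenever `8t + 11s < s²`** (`tropRowD_notTight_window`; `κ(2^16) ≤ 2^16 − 10`, `κ(2^20) ≤ 2^20 − 23`), i.e.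
  `κ(m) ≤ m − Ω(log₂² m)` along `m = 2^s`.  `TropicalB` predicts `κ(m) = O(log m)`; this file moves the unconditional ceiling from `16m` to just
  below `m` at dyadic sizes.  Not done here: general (non-dyadic) `m` (needs the balanced recursion with odd steps `C(2a+1, a)`), and any `K`
  deeper in the window than `m − O(log² m)` (halving cannot: `C(m+K−1, m) < 4^m/m^{O(log m)}` already at `K = m − ω(log² m)`).
[folklore: Wallis/Erdős central-binomial bounds; the rest is this cell's census bookkeeping]
-/

set_option linter.dupNamespace false
set_option autoImplicit false

namespace Summit.ValiantsHypothesis.ValiantsHypothesis.Theorems.KPlusLogSqLaw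

open Finset
open scoped BigOperators

namespace HalvingProduct

/-! ### 1. The two central-binomial bounds used (both already in the tree / Mathlib) -/

/-- `C(2m, m) = 2·C(2m−1, m)` for `m ≥ 1`. [folklore] -/
theorem centralBinom_eq_two_mul_choose_pred (m : ℕ) (hm : 1 ≤ m) : m.centralBinom = 2 * (2 * m - 1).choose m := by
  obtain ⟨a, rfl⟩ : ∃ a, m = a + 1 := ⟨m - 1, by omega⟩
  rw [Nat.centralBinom_eq_two_mul_choose, show 2 * (a + 1) - 1 = 2 * a + 1 by omega,
    show 2 * (a + 1) = (2 * a + 1) + 1 by ring, Nat.choose_succ_succ', Nat.choose_symm_half]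
  ring

/-- `multichoose m m = C(2m−1, m)` is the slope-counting ceiling of the diagonal format `(m, m)`. [folklore] -/
theorem multichoose_self (m : ℕ) : Nat.multichoose m m = (2 * m - 1).choose m := by
  rw [Nat.multichoose_eq, two_mul]

/-- Erdős's lower bound at the diagonal: `4·16^(m−1) ≤ m²·C(2m−1, m)²` for `m ≥ 4` (square of Mathlib's
`Nat.four_pow_lt_mul_centralBinom : 4^m < m·C(2m,m)`, with `C(2m,m) = 2·C(2m−1,m)`). [folklore] -/
theorem sixteen_pow_pred_le (m : ℕ) (hm : 4 ≤ m) : 4 * 16 ^ (m - 1) ≤ m ^ 2 * ((2 * m - 1).choose m) ^ 2 := by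
  have h := (Nat.four_pow_lt_mul_centralBinom m hm).le
  rw [centralBinom_eq_two_mul_choose_pred m (by omega)] at h
  have h2 := Nat.mul_le_mul h h
  have e0 : (16 : ℕ) ^ m = 16 * 16 ^ (m - 1) := by
    rw [← pow_succ']; congr 1; omega
  have e1 : 4 ^ m * 4 ^ m = 4 * (4 * 16 ^ (m - 1)) := by
    rw [← mul_pow, show (4 : ℕ) * 4 = 16 by norm_num, e0]; ring
  have e2 : m * (2 * (2 * m - 1).choose m) * (m * (2 * (2 * m - 1).choose m)) = 4 * (m ^ 2 * ((2 * m - 1).choose m) ^ 2) := by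
    ring
  rw [e1, e2] at h2
  exact Nat.le_of_mul_le_mul_left h2 (by norm_num)

/-! ### 2. The halving product law along dyadic sizes -/

/-- **HALVING PRODUCT LAW.**  `T_D(2^s, K) + 1 ≤ K · 2^s · ∏_{j<s} C(2^{j+1}, 2^j)`: the dyadic halving recursion of
`tropRowD_halving` kept as a product (base `tropRowD_one`: `T_D(1,K) = K − 1`). [this cell] -/
theorem tropRowD_two_pow_prod (s K : ℕ) :
    TropRowD (2 ^ s) K (K * 2 ^ s * ∏ j ∈ range s, (2 ^ j).centralBinom - 1) := by
  rcases Nat.eq_zero_or_pos K with rfl | hK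
  · exact tropRowD_zero _ _
  induction s with
  | zero => simpa using tropRowD_one K
  | succ s ih =>
    have hh := tropRowD_halving ih ih
    have e2 : 2 ^ (s + 1) = 2 ^ s + 2 ^ s := by rw [pow_succ]; ring
    rw [e2]
    refine tropRowD_mono ?_ hh
    set P := ∏ j ∈ range s, (2 ^ j).centralBinom with hP
    have hPpos : 0 < P := by
      rw [hP]; exact prod_pos fun j _ => Nat.centralBinom_pos _
    have hX : 1 ≤ K * 2 ^ s * P := Nat.mul_pos (Nat.mul_pos hK (Nat.two_pow_pos s)) hPpos
    have hC : (2 ^ s + 2 ^ s).choose (2 ^ s) = (2 ^ s).centralBinom := by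
      rw [Nat.centralBinom_eq_two_mul_choose, two_mul]
    rw [prod_range_succ, hC]
    -- `C·((X−1)+(X−1)+1) − 1 ≤ 2·C·X − 1 = K·(2^s+2^s)·(P·C) − 1`
    have h2X : ∀ X : ℕ, 1 ≤ X → X - 1 + (X - 1) + 1 ≤ 2 * X := fun X hX1 => by omega
    have h1 : (2 ^ s).centralBinom * (K * 2 ^ s * P - 1 + (K * 2 ^ s * P - 1) + 1)
        ≤ (2 ^ s).centralBinom * (2 * (K * 2 ^ s * P)) := Nat.mul_le_mul_left _ (h2X _ hX)
    have h2 : (2 ^ s).centralBinom * (2 * (K * 2 ^ s * P)) = K * (2 ^ s + 2 ^ s) * (P * (2 ^ s).centralBinom) := by ring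
    rw [h2] at h1
    exact Nat.sub_le_sub_right h1 1

/-- signed form of the halving product law. [this cell] -/
theorem tropRootLawAt_two_pow_prod (s K : ℕ) :
    LacunarySymmetroidMatrixDescartes.TropicalCensus.TropRootLawAt (2 ^ s) K
      (K * 2 ^ s * ∏ j ∈ range s, (2 ^ j).centralBinom - 1) :=
  tropRootLawAt_of_tropRowD (tropRowD_two_pow_prod s K)

/-! ### 3. The size of the halving product -/

/-- `(∏_{j<s} C(2^{j+1},2^j))² · ∏_{j<s} (3·2^j + 1) ≤ 16^(2^s − 1)`: the tree's upper Wallis bound `C(2n,n)²(3n+1) ≤ 16^n`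
(`Literature.Probability.LatticeModels.UniformStep.centralBinom_sq_mul_le`) at every level `n = 2^j`. [this cell] -/
theorem prod_centralBinom_sq_mul_le (s : ℕ) :
    (∏ j ∈ range s, (2 ^ j).centralBinom) ^ 2 * ∏ j ∈ range s, (3 * 2 ^ j + 1) ≤ 16 ^ (2 ^ s - 1) := by
  induction s with
  | zero => simp
  | succ s ih =>
    have hlev := Literature.Probability.LatticeModels.UniformStep.centralBinom_sq_mul_le (2 ^ s)
    have e : 16 ^ (2 ^ s - 1) * 16 ^ (2 ^ s) = 16 ^ (2 ^ (s + 1) - 1) := by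
      rw [← pow_add]
      congr 1
      have := Nat.two_pow_pos s
      rw [pow_succ]
      omega
    calc (∏ j ∈ range (s + 1), (2 ^ j).centralBinom) ^ 2 * ∏ j ∈ range (s + 1), (3 * 2 ^ j + 1)
        = ((∏ j ∈ range s, (2 ^ j).centralBinom) ^ 2 * ∏ j ∈ range s, (3 * 2 ^ j + 1)) *
          ((2 ^ s).centralBinom ^ 2 * (3 * 2 ^ s + 1)) := by
          rw [prod_range_succ, prod_range_succ, mul_pow, mul_mul_mul_comm]
      _ ≤ 16 ^ (2 ^ s - 1) * 16 ^ (2 ^ s) := by gcongr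
      _ = 16 ^ (2 ^ (s + 1) - 1) := e

/-- `3^s · 2^(s(s−1)/2) ≤ ∏_{j<s} (3·2^j + 1)`. [arithmetic] -/
theorem three_pow_mul_two_pow_le_prod (s : ℕ) :
    3 ^ s * 2 ^ (s * (s - 1) / 2) ≤ ∏ j ∈ range s, (3 * 2 ^ j + 1) := by
  have hsum : ∑ j ∈ range s, j = s * (s - 1) / 2 := by
    have := sum_range_id_mul_two s
    omega
  calc 3 ^ s * 2 ^ (s * (s - 1) / 2) = 3 ^ s * 2 ^ (∑ j ∈ range s, j) := by rw [hsum]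
    _ = (∏ _j ∈ range s, 3) * ∏ j ∈ range s, 2 ^ j := by
        rw [prod_const, card_range, prod_pow_eq_pow_sum]
    _ = ∏ j ∈ range s, (3 * 2 ^ j) := by rw [← prod_mul_distrib]
    _ ≤ ∏ j ∈ range s, (3 * 2 ^ j + 1) := prod_le_prod (fun _ _ => Nat.zero_le _) fun j _ => Nat.le_succ _

/-- **Closed form of the halving product law**: `(K·2^s·∏_{j<s} C(2^{j+1},2^j))² · 3^s · 2^(s(s−1)/2) ≤ K² · 4^s · 16^(2^s − 1)`,
i.e. with `m = 2^s` the unsigned row satisfies `(T_D(m,K) + 1)²·3^s·2^(s(s−1)/2) ≤ K²·m²·16^(m−1)`: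
`T_D(m,K) + 1 ≤ K·4^(m−1)·2^s·3^(−s/2)·2^(−s(s−1)/4)` — below the tree's `K·4^(m−1)` by the quasi-polynomial factor
`2^((s² − s)/4)·(3/4)^(s/2)` (`> 1` from `s = 2` on; `≈ 2^20` at `m = 1024`). [this cell] -/
theorem halvingProduct_closed_form (s K : ℕ) :
    (K * 2 ^ s * ∏ j ∈ range s, (2 ^ j).centralBinom) ^ 2 * (3 ^ s * 2 ^ (s * (s - 1) / 2))
      ≤ K ^ 2 * 4 ^ s * 16 ^ (2 ^ s - 1) := by
  have h3 := three_pow_mul_two_pow_le_prod s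
  have hP := prod_centralBinom_sq_mul_le s
  have h4 : (2 ^ s) ^ 2 = 4 ^ s := by
    rw [← pow_mul, mul_comm, pow_mul]; norm_num
  calc (K * 2 ^ s * ∏ j ∈ range s, (2 ^ j).centralBinom) ^ 2 * (3 ^ s * 2 ^ (s * (s - 1) / 2))
      ≤ (K * 2 ^ s * ∏ j ∈ range s, (2 ^ j).centralBinom) ^ 2 * ∏ j ∈ range s, (3 * 2 ^ j + 1) := by gcongr
    _ = K ^ 2 * (2 ^ s) ^ 2 * ((∏ j ∈ range s, (2 ^ j).centralBinom) ^ 2 * ∏ j ∈ range s, (3 * 2 ^ j + 1)) := by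
        rw [mul_pow, mul_pow, mul_assoc]
    _ ≤ K ^ 2 * (2 ^ s) ^ 2 * 16 ^ (2 ^ s - 1) := by gcongr
    _ = K ^ 2 * 4 ^ s * 16 ^ (2 ^ s - 1) := by rw [h4]

/-! ### 4. The counting-tightness threshold enters the window -/

/-- `3^t · C(2m−1−t, m) ≥ C(2m−1, m)` for `2t + 2 ≤ m`: removing one unit from the top of `C(n, m)` costs at most a factor `3`
while `n ≥ 3m/2`-ish (`C(n+1,m)·(n+1−m) = C(n,m)·(n+1)`). [arithmetic] -/
theorem choose_le_three_pow_mul_choose_sub (m t : ℕ) (ht : 2 * t + 2 ≤ m) :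
    (2 * m - 1).choose m ≤ 3 ^ t * (2 * m - 1 - t).choose m := by
  induction t with
  | zero => simp
  | succ t ih =>
    have ih' := ih (by omega)
    -- one step: `C(2m−1−t, m) ≤ 3·C(2m−2−t, m)` via `C(n,m)·(n+1) = C(n+1,m)·(n+1−m)` at `n = 2m−2−t`
    have hstep : (2 * m - 1 - t).choose m ≤ 3 * (2 * m - 1 - (t + 1)).choose m := by
      have hpos : 0 < m - 1 - t := by omega
      refine Nat.le_of_mul_le_mul_right ?_ hpos
      have key := Nat.choose_mul_succ_eq (2 * m - 1 - (t + 1)) m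
      have e1 : 2 * m - 1 - (t + 1) + 1 = 2 * m - 1 - t := by omega
      rw [e1] at key
      have e2 : 2 * m - 1 - t - m = m - 1 - t := by omega
      rw [e2] at key
      -- key : `C(2m−2−t, m)·(2m−1−t) = C(2m−1−t, m)·(m−1−t)`, and `2m−1−t ≤ 3(m−1−t)`
      calc (2 * m - 1 - t).choose m * (m - 1 - t) = (2 * m - 1 - (t + 1)).choose m * (2 * m - 1 - t) := key.symm
        _ ≤ (2 * m - 1 - (t + 1)).choose m * (3 * (m - 1 - t)) := Nat.mul_le_mul_left _ (by omega)
        _ = 3 * (2 * m - 1 - (t + 1)).choose m * (m - 1 - t) := by ring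
    calc (2 * m - 1).choose m ≤ 3 ^ t * (2 * m - 1 - t).choose m := ih'
      _ ≤ 3 ^ t * (3 * (2 * m - 1 - (t + 1)).choose m) := Nat.mul_le_mul_left _ hstep
      _ = 3 ^ (t + 1) * (2 * m - 1 - (t + 1)).choose m := by ring

/-- **Non-tightness criterion at `(2^s, 2^s − t)`**: if `2t + 2 ≤ 2^s`, `s ≥ 2` and `9^t · 64^s < 4·∏_{j<s}(3·2^j + 1)`, then no
design of format `(2^s, 2^s − t)` has a dominant chain through all `multichoose (2^s − t) (2^s)` class multisets.  (A tight chain would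
give `C(2m−1−t, m) ≤ (m−t)·m·∏ C` by §2, hence with §1, §3 `4·∏(3·2^j+1) ≤ 9^t·m⁶`.) [this cell] -/
theorem tropRowD_notTight_two_pow_sub (s t : ℕ) (hs : 2 ≤ s) (ht : 2 * t + 2 ≤ 2 ^ s)
    (hQ : 9 ^ t * 64 ^ s < 4 * ∏ j ∈ range s, (3 * 2 ^ j + 1)) :
    TropRowD (2 ^ s) (2 ^ s - t) (Nat.multichoose (2 ^ s - t) (2 ^ s) - 2) := by
  set m := 2 ^ s with hm
  set P := ∏ j ∈ range s, (2 ^ j).centralBinom with hP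
  set Q := ∏ j ∈ range s, (3 * 2 ^ j + 1) with hQdef
  have hm4 : 4 ≤ m := by
    have : 2 ^ 2 ≤ 2 ^ s := Nat.pow_le_pow_right (by norm_num) hs
    rw [hm]; omega
  have hPpos : 0 < P := by rw [hP]; exact prod_pos fun j _ => Nat.centralBinom_pos _
  have hrow := tropRowD_two_pow_prod s (m - t)
  rw [← hm, ← hP] at hrow
  -- the counting ceiling of the format
  have hN : Nat.multichoose (m - t) m = (2 * m - 1 - t).choose m := by
    rw [Nat.multichoose_eq]; congr 1; omega
  rw [hN]
  refine tropRowD_mono ?_ hrow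
  -- it remains: `(m−t)·m·P − 1 ≤ C(2m−1−t, m) − 2`, i.e. `(m−t)·m·P + 1 ≤ C(2m−1−t, m)`
  suffices hmain : (m - t) * m * P + 1 ≤ (2 * m - 1 - t).choose m by omega
  by_contra hcon
  push Not at hcon
  have hC : (2 * m - 1 - t).choose m ≤ m * m * P := by
    calc (2 * m - 1 - t).choose m ≤ (m - t) * m * P := by omega
      _ ≤ m * m * P := Nat.mul_le_mul_right _ (Nat.mul_le_mul_right _ (Nat.sub_le _ _))
  -- `C(2m−1,m) ≤ 3^t · m² · P`
  have hC0 : (2 * m - 1).choose m ≤ 3 ^ t * (m * m * P) :=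
    (choose_le_three_pow_mul_choose_sub m t ht).trans (Nat.mul_le_mul_left _ hC)
  -- `4·P²·Q ≤ 4·16^(m−1) ≤ m²·C(2m−1,m)² ≤ m²·9^t·m⁴·P²`
  have h1 : P ^ 2 * Q ≤ 16 ^ (m - 1) := prod_centralBinom_sq_mul_le s
  have h2 : 4 * 16 ^ (m - 1) ≤ m ^ 2 * ((2 * m - 1).choose m) ^ 2 := sixteen_pow_pred_le m hm4
  have h3 : m ^ 2 * ((2 * m - 1).choose m) ^ 2 ≤ m ^ 2 * (3 ^ t * (m * m * P)) ^ 2 :=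
    Nat.mul_le_mul_left _ (Nat.pow_le_pow_left hC0 2)
  have hm6 : m ^ 6 = 64 ^ s := by
    rw [hm, ← pow_mul, mul_comm, pow_mul]; norm_num
  have h9 : (3 ^ t) ^ 2 = 9 ^ t := by
    rw [← pow_mul, mul_comm, pow_mul]; norm_num
  have h4 : P ^ 2 * (4 * Q) ≤ P ^ 2 * (9 ^ t * 64 ^ s) := by
    calc P ^ 2 * (4 * Q) = 4 * (P ^ 2 * Q) := by ring
      _ ≤ 4 * 16 ^ (m - 1) := Nat.mul_le_mul_left _ h1
      _ ≤ m ^ 2 * (3 ^ t * (m * m * P)) ^ 2 := h2.trans h3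
      _ = P ^ 2 * ((3 ^ t) ^ 2 * m ^ 6) := by ring
      _ = P ^ 2 * (9 ^ t * 64 ^ s) := by rw [h9, hm6]
  have h5 : 4 * Q ≤ 9 ^ t * 64 ^ s := Nat.le_of_mul_le_mul_left h4 (Nat.pow_pos hPpos)
  exact absurd hQ (not_lt.mpr h5)

/-- `64^s < 4·∏_{j<s}(3·2^j + 1)` for every `s ≥ 10` (at `s = 10` the product is `≈ 3.8·10¹⁸ > 2^60/4`; each further factor
`3·2^s + 1` exceeds `64`). [arithmetic] -/
theorem sixtyfour_pow_lt_prod (s : ℕ) (hs : 10 ≤ s) : 64 ^ s < 4 * ∏ j ∈ range s, (3 * 2 ^ j + 1) := by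
  induction s, hs using Nat.le_induction with
  | base => simp only [prod_range_succ, prod_range_zero]; norm_num
  | succ s hs ih =>
    rw [prod_range_succ, pow_succ, ← mul_assoc]
    have h64 : 64 < 3 * 2 ^ s + 1 := by
      have : 2 ^ 10 ≤ 2 ^ s := Nat.pow_le_pow_right (by norm_num) hs
      omega
    exact Nat.mul_lt_mul'' ih h64

/-- `9·64^s < 4·∏_{j<s}(3·2^j + 1)` for every `s ≥ 10`. [arithmetic] -/
theorem nine_mul_sixtyfour_pow_lt_prod (s : ℕ) (hs : 10 ≤ s) : 9 * 64 ^ s < 4 * ∏ j ∈ range s, (3 * 2 ^ j + 1) := by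
  induction s, hs using Nat.le_induction with
  | base => simp only [prod_range_succ, prod_range_zero]; norm_num
  | succ s hs ih =>
    rw [prod_range_succ, pow_succ, ← mul_assoc, ← mul_assoc]
    have h64 : 64 < 3 * 2 ^ s + 1 := by
      have : 2 ^ 10 ≤ 2 ^ s := Nat.pow_le_pow_right (by norm_num) hs
      omega
    exact Nat.mul_lt_mul'' ih h64

/-- **`κ(2^s) < 2^s` for every `s ≥ 10`**: the diagonal format `(2^s, 2^s)` (`m ≥ 1024` a power of two) is NOT counting-tight —
no design carries a dominant chain through all `C(2m−1, m)` class multisets. [this cell] -/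
theorem tropRowD_notTight_diag (s : ℕ) (hs : 10 ≤ s) :
    TropRowD (2 ^ s) (2 ^ s) (Nat.multichoose (2 ^ s) (2 ^ s) - 2) := by
  have h := tropRowD_notTight_two_pow_sub s 0 (by omega)
    (by have := Nat.pow_le_pow_right (show 0 < 2 by norm_num) hs; omega)
    (by simpa using sixtyfour_pow_lt_prod s hs)
  simpa using h

/-- … hence `(2^s, K)` is not counting-tight for ANY `K ≥ 2^s` (`s ≥ 10`), by the propagation law
`Tightness.tropRowD_notTight_mono`. [this cell] -/
theorem tropRowD_notTight_two_pow_le (s K : ℕ) (hs : 10 ≤ s) (hK : 2 ^ s ≤ K) :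
    TropRowD (2 ^ s) K (Nat.multichoose K (2 ^ s) - 2) :=
  Tightness.tropRowD_notTight_mono (by have := Nat.pow_le_pow_right (show 0 < 2 by norm_num) hs; omega) hK
    (tropRowD_notTight_diag s hs)

/-- **The first non-tight formats strictly INSIDE the crux window**: for `s ≥ 10` the format `(2^s, 2^s − 1)` (e.g. `(1024, 1023)`;
`⌊log₂ m⌋ + 1 < K = m − 1 < m`) is not counting-tight, so `κ(2^s) ≤ 2^s − 2`. [this cell] -/
theorem tropRowD_notTight_window_one (s : ℕ) (hs : 10 ≤ s) :
    TropRowD (2 ^ s) (2 ^ s - 1) (Nat.multichoose (2 ^ s - 1) (2 ^ s) - 2) :=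
  tropRowD_notTight_two_pow_sub s 1 (by omega) (by have := Nat.pow_le_pow_right (show 0 < 2 by norm_num) hs; omega)
    (by simpa using nine_mul_sixtyfour_pow_lt_prod s hs)

/-- `κ(2^s) ≤ 2^s − 2` for `s ≥ 10`, in the propagated form: every `K ≥ 2^s − 1` is non-tight at size `2^s`. [this cell] -/
theorem tropRowD_notTight_window_one_le (s K : ℕ) (hs : 10 ≤ s) (hK : 2 ^ s - 1 ≤ K) :
    TropRowD (2 ^ s) K (Nat.multichoose K (2 ^ s) - 2) :=
  Tightness.tropRowD_notTight_mono (by have := Nat.pow_le_pow_right (show 0 < 2 by norm_num) hs; omega) hK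
    (tropRowD_notTight_window_one s hs)

/-- **`κ(m) ≤ m − Ω(log₂² m)` along dyadic sizes**: if `8t + 11s < s²` then the format `(2^s, 2^s − t)` is not counting-tight
(crude arithmetic form of §3: `9^t·64^s ≤ 2^(4t+6s) < 2^(s + s(s−1)/2) ≤ 3^s·2^(s(s−1)/2) ≤ ∏(3·2^j+1)`); e.g. `κ(2^16) ≤ 2^16 − 10`,
`κ(2^20) ≤ 2^20 − 23`. [this cell] -/
theorem tropRowD_notTight_window (s t : ℕ) (h : 8 * t + 11 * s < s * s) :
    TropRowD (2 ^ s) (2 ^ s - t) (Nat.multichoose (2 ^ s - t) (2 ^ s) - 2) := by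
  have hs : 12 ≤ s := by nlinarith
  -- `s² ≤ 2^s` for `s ≥ 4`, whence `2t + 2 ≤ 2^s`
  have hsq : ∀ n : ℕ, 4 ≤ n → n * n ≤ 2 ^ n := by
    intro n hn
    induction n, hn using Nat.le_induction with
    | base => norm_num
    | succ n hn ih =>
      have h2 : 2 * n + 1 ≤ n * n := by nlinarith
      calc (n + 1) * (n + 1) = n * n + (2 * n + 1) := by ring
        _ ≤ 2 ^ n + 2 ^ n := Nat.add_le_add ih (h2.trans ih)
        _ = 2 ^ (n + 1) := by rw [pow_succ]; ring
  have ht : 2 * t + 2 ≤ 2 ^ s := by nlinarith [hsq s (by omega)]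
  refine tropRowD_notTight_two_pow_sub s t (by omega) ht ?_
  -- `4t + 6s < s(s−1)/2 + s` from `8t + 11s < s²` (`s(s−1)` is even)
  have hu : s * (s - 1) = s * s - s := Nat.mul_sub_one s s
  obtain ⟨k, hk⟩ := Nat.even_mul_pred_self s
  have hlt : 4 * t + 6 * s < s * (s - 1) / 2 + s := by omega
  calc 9 ^ t * 64 ^ s ≤ 16 ^ t * 64 ^ s := Nat.mul_le_mul_right _ (Nat.pow_le_pow_left (by norm_num) t)
    _ = 2 ^ (4 * t + 6 * s) := by rw [pow_add, pow_mul, pow_mul]; norm_num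
    _ < 2 ^ (s * (s - 1) / 2 + s) := Nat.pow_lt_pow_right (by norm_num) hlt
    _ ≤ 3 ^ s * 2 ^ (s * (s - 1) / 2) := by
        rw [pow_add, mul_comm]
        exact Nat.mul_le_mul_right _ (Nat.pow_le_pow_left (by norm_num) s)
    _ ≤ ∏ j ∈ range s, (3 * 2 ^ j + 1) := three_pow_mul_two_pow_le_prod s
    _ ≤ 4 * ∏ j ∈ range s, (3 * 2 ^ j + 1) := Nat.le_mul_of_pos_left _ (by norm_num)

end HalvingProduct

end Summit.ValiantsHypothesis.ValiantsHypothesis.Theorems.KPlusLogSqLaw
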